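import Mathlib
import Summits.KontsevichZagierPeriods.Zeta5Search.ThirdDigitSeries
import Summits.KontsevichZagierPeriods.Zeta5Search.GHatThirdOrder
import Summits.KontsevichZagierPeriods.Zeta5Search.SecondDigitWProof
import HarnessLib

/-!
# ζ(5) search — the CLASSWISE THIRD-DIGIT LEMMA for the `W`-row is a THEOREM (gen-2 g10's (W3), `ThirdDigitW`)

Cell `pub-zeta5` (HONEST FRAMING: systematic search; no irrationality claim unless certified), typer seat generation 12.
Discharges BY NAME `SecondOrder.ThirdDigitW` of `Zeta5Search/ThirdOrderDigit.lean` (gen-2 g10, REPORT-gen2-g10 §6.2, exact check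
318,826 pole classes): for a residue class with base `x < p` (window `5 ≤ p`, `b₀ + 2 < p²`),
**`v_p( W_x − (−p)^{E_x+3} ĝ_x (ŵ_x − p φ_x ŵ₂_x + p² c_x ŵ₃_x) ) ≥ E_x + 6`**, `W_x = Σ_{s ∈ x} c_{2,s}`.
Proof: Theorem B to third order at `σ = 3` for every pole of order `≥ 3` (`leadingDigit₃`: digit `ĝ_s(ρ_{s,3} − pφ_sρ_{s,4} + p²c_sρ_{s,5})`),
then the units are moved to the base: `ĝ_s ≡ ĝ_x(1 − ℓ_s pφ_x + ℓ_s²p²c_x) (mod p³)` (`padicNorm_gHat_sub_third_le`),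
`φ_s ≡ φ_x + ℓ_s pφ₂,x (mod p²)` (`padicNorm_phiHat_sub_second_le`), `c_s ≡ c_x (mod p)`; the identity `φ_x² − φ₂,x = 2c_x` turns the
cross terms into `−pφ_x(ℓρ₃ + ρ₄) + p²c_x(ℓ²ρ₃ + 2ℓρ₄ + ρ₅)` — the functionals `ŵ₂ = ŵ[ηΦ_x]`, `ŵ₃ = ŵ[η²Φ_x]`.
`p`-adic valuations of rational numbers; nothing here concerns irrationality.
-/

noncomputable section

open Finset PowerSeries

namespace Summit.KontsevichZagierPeriods.Zeta5Search.SecondOrder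

open Summit.KontsevichZagierPeriods.Zeta5Search.DualSeries (InBox)
open Summit.KontsevichZagierPeriods.Zeta5Search.WedgeDictionary (pfData)
open Summit.KontsevichZagierPeriods.Zeta5Search.CasoratianValuation (InPolytope)
open Summit.KontsevichZagierPeriods.Zeta5Search.ClusterValuation
open Summit.KontsevichZagierPeriods.Zeta5Search.PadicSeries
open Summit.KontsevichZagierPeriods.Zeta5Search.CellA (padicNorm_classRho_le_one pfData_eq_zero_of_order_le gHat_classCongr
  padicNorm_pow_eq padicNorm_mul_sub_mul_le padicNorm_p)

variable {p : ℕ} [hp : Fact p.Prime]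

/-- The third-order transport identity behind (W3): with `φ₂ = φ² − 2c`,
`(1 − ℓpφ + ℓ²p²c)(ρ₃ − pφ'ρ₄ + p²c'ρ₅) − (ρ₃ − pφ(ℓρ₃ + ρ₄) + p²c(ℓ²ρ₃ + 2ℓρ₄ + ρ₅))`
`= −p(φ' − φ − ℓpφ₂)ρ₄ + p²(c' − c)ρ₅ + ℓp²φ(φ' − φ)ρ₄ + p³(−ℓφc'ρ₅ − ℓ²cφ'ρ₄ + ℓ²p c c'ρ₅)`. -/
theorem thirdOrder_transport_identity (pp ℓ φ φ' φ₂ c c' ρ3 ρ4 ρ5 : ℚ) (hφ2 : φ₂ = φ ^ 2 - 2 * c) :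
    (1 - ℓ * pp * φ + (ℓ * pp) ^ 2 * c) * (ρ3 - pp * φ' * ρ4 + pp ^ 2 * c' * ρ5)
      - (ρ3 - pp * φ * (ℓ * ρ3 + ρ4) + pp ^ 2 * c * (ℓ ^ 2 * ρ3 + 2 * ℓ * ρ4 + ρ5)) =
    -pp * (φ' - (φ + ℓ * pp * φ₂)) * ρ4 + pp ^ 2 * (c' - c) * ρ5 + ℓ * pp ^ 2 * φ * (φ' - φ) * ρ4
      + pp ^ 3 * (-ℓ * φ * c' * ρ5 - ℓ ^ 2 * c * φ' * ρ4 + ℓ ^ 2 * pp * c * c' * ρ5) := by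
  rw [hφ2]; ring

/-- **(W3) — the classwise third digit of the `W`-row (gen-2 g10's `ThirdDigitW`) is a theorem.** -/
theorem thirdDigitW_holds : ThirdDigitW := by
  intro b p x hb hprime hp5 hwin hx hpole hne
  haveI : Fact p.Prime := ⟨hprime⟩
  obtain ⟨hbox, -, -, hn⟩ := thmA_data b hb hwin
  have h0 : 0 ≤ b 0 := hbox.1
  have hp2 : p ≠ 2 := by omega
  have hp0 : (p : ℚ) ≠ 0 := Nat.cast_ne_zero.2 hprime.ne_zero
  have hp' : (-(p : ℚ)) ≠ 0 := neg_ne_zero.2 hp0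
  have hxmem : x ∈ classSet b p x := base_mem_classSet b hx hpole
  set E := classExp b p x with hE
  set g := gHat b p x with hg
  set φ := phiHat b p x with hφ
  set φ₂ := phi2Hat b p x with hφ₂
  set c := curvHat b p x with hc
  have hφ2c : φ₂ = φ ^ 2 - 2 * c := by rw [hc, curvHat]; ring
  -- `ŵ`, `ŵ₂`, `ŵ₃` as sums over the whole class
  have hw : wHat b p x = ∑ s ∈ classSet b p x, (if netExp b s ≤ -3 then classRho b p s 3 else 0) := by
    rw [wHat, classPoles, sum_filter]
    refine sum_congr rfl fun s _ => ?_
    by_cases h3 : netExp b s ≤ -3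
    · rw [if_pos (by omega), if_pos h3]
    · rw [if_neg h3]; split_ifs <;> rfl
  have hw2 : wHat2 b p x = ∑ s ∈ classSet b p x,
      ((if netExp b s ≤ -3 then ((s / p : ℕ) : ℚ) * classRho b p s 3 else 0)
        + (if netExp b s ≤ -4 then classRho b p s 4 else 0)) := by
    rw [wHat2, classPoles, sum_filter]
    refine sum_congr rfl fun s _ => ?_
    by_cases h3 : netExp b s ≤ -3
    · rw [if_pos (by omega)]
    · rw [if_neg h3, if_neg (show ¬ netExp b s ≤ -4 by omega)]; split_ifs <;> simp
  have hw3 : wHat3 b p x = ∑ s ∈ classSet b p x,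
      ((if netExp b s ≤ -3 then ((s / p : ℕ) : ℚ) ^ 2 * classRho b p s 3 else 0)
        + (if netExp b s ≤ -4 then 2 * ((s / p : ℕ) : ℚ) * classRho b p s 4 else 0)
        + (if netExp b s ≤ -5 then classRho b p s 5 else 0)) := by
    rw [wHat3, classPoles, sum_filter]
    refine sum_congr rfl fun s _ => ?_
    by_cases h3 : netExp b s ≤ -3
    · rw [if_pos (by omega)]
    · rw [if_neg h3, if_neg (show ¬ netExp b s ≤ -4 by omega), if_neg (show ¬ netExp b s ≤ -5 by omega)]
      split_ifs <;> simp
  -- the termwise form of the difference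
  set T : ℕ → ℚ := fun s => pfData b 2 s - (-(p : ℚ)) ^ (E + 3) * g *
      ((if netExp b s ≤ -3 then classRho b p s 3 else 0)
        - (p : ℚ) * φ * ((if netExp b s ≤ -3 then ((s / p : ℕ) : ℚ) * classRho b p s 3 else 0)
            + (if netExp b s ≤ -4 then classRho b p s 4 else 0))
        + (p : ℚ) ^ 2 * c * ((if netExp b s ≤ -3 then ((s / p : ℕ) : ℚ) ^ 2 * classRho b p s 3 else 0)
            + (if netExp b s ≤ -4 then 2 * ((s / p : ℕ) : ℚ) * classRho b p s 4 else 0)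
            + (if netExp b s ≤ -5 then classRho b p s 5 else 0))) with hT
  have hsplit : (∑ s ∈ classSet b p x, pfData b 2 s)
      - (-(p : ℚ)) ^ (E + 3) * g * (wHat b p x - (p : ℚ) * φ * wHat2 b p x + (p : ℚ) ^ 2 * c * wHat3 b p x) =
      ∑ s ∈ classSet b p x, T s := by
    rw [hw, hw2, hw3, hT, mul_sum, mul_sum, ← sum_sub_distrib, ← sum_add_distrib, mul_sum, ← sum_sub_distrib]
  -- common norms
  have hpow : padicNorm p ((-(p : ℚ)) ^ (E + 3)) = (p : ℚ) ^ (-(E + 3)) := by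
    rw [padicNorm.eq_zpow_of_nonzero (zpow_ne_zero _ hp'), padicValRat.zpow, padicValRat.neg,
      padicValRat.self hprime.one_lt, mul_one]
  have hgx1 : padicNorm p g ≤ 1 := (padicNorm_gHat_class b hb hp5 hx hxmem hxmem).1
  have hφ1 : padicNorm p φ ≤ 1 := padicNorm_phiHat_le_one b hp2 x
  have hc1 : padicNorm p c ≤ 1 := padicNorm_curvHat_le_one b hp2 x
  have hpn : padicNorm p (p : ℚ) = (p : ℚ) ^ (-(1 : ℤ)) := padicNorm_p
  -- termwise bound `p^{-(E+6)}`
  have hterm : ∀ s ∈ classSet b p x, padicNorm p (T s) ≤ (p : ℚ) ^ (-(E + 6)) := by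
    intro s hs
    have hsn : s ≤ (b 0).toNat := ((mem_classSet_iff b x s).1 hs).1
    have hEs : classExp b p s = E := classExp_eq_of_mem hs
    by_cases h3 : netExp b s ≤ -3
    · -- a pole of order ≥ 3: third-order Theorem B, then move the units to the base
      have hTs : T s = pfData b 2 s - (-(p : ℚ)) ^ (E + 3) * g *
          (classRho b p s 3 - (p : ℚ) * φ * (((s / p : ℕ) : ℚ) * classRho b p s 3
              + (if netExp b s ≤ -4 then classRho b p s 4 else 0))
            + (p : ℚ) ^ 2 * c * (((s / p : ℕ) : ℚ) ^ 2 * classRho b p s 3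
              + (if netExp b s ≤ -4 then 2 * ((s / p : ℕ) : ℚ) * classRho b p s 4 else 0)
              + (if netExp b s ≤ -5 then classRho b p s 5 else 0))) := by
        simp only [hT, if_pos h3]
      have hρ4' : (if netExp b s ≤ -4 then 2 * ((s / p : ℕ) : ℚ) * classRho b p s 4 else 0)
          = 2 * ((s / p : ℕ) : ℚ) * (if netExp b s ≤ -4 then classRho b p s 4 else 0) := by
        split_ifs <;> ring
      rw [hρ4'] at hTs
      set ρ3 := classRho b p s 3 with hρ3
      set ρ4 : ℚ := if netExp b s ≤ -4 then classRho b p s 4 else 0 with hρ4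
      set ρ5 : ℚ := if netExp b s ≤ -5 then classRho b p s 5 else 0 with hρ5
      set gs := gHat b p s with hgs
      set φs := phiHat b p s with hφs
      set cs := curvHat b p s with hcs
      set ℓ : ℚ := ((s / p : ℕ) : ℚ) with hℓ
      -- Theorem B to third order at σ = 3
      have hB : padicNorm p (pfData b 2 s - (-(p : ℚ)) ^ (E + 3) * gs * (ρ3 - (p : ℚ) * φs * ρ4 + (p : ℚ) ^ 2 * cs * ρ5)) ≤
          (p : ℚ) ^ (-(E + 6)) := by
        have h := leadingDigit₃ b hb hp5 hwin hsn (σ := 3) (by norm_num) (by push_cast; omega)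
        have e4 : (if ((3 : ℕ) : ℤ) + 1 ≤ -netExp b s then classRho b p s (3 + 1) else 0) = ρ4 := by
          rw [hρ4]
          by_cases h4 : netExp b s ≤ -4
          · rw [if_pos (by push_cast; omega), if_pos h4]
          · rw [if_neg (by push_cast; omega), if_neg h4]
        have e5 : (if ((3 : ℕ) : ℤ) + 2 ≤ -netExp b s then classRho b p s (3 + 2) else 0) = ρ5 := by
          rw [hρ5]
          by_cases h5 : netExp b s ≤ -5
          · rw [if_pos (by push_cast; omega), if_pos h5]
          · rw [if_neg (by push_cast; omega), if_neg h5]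
        rw [e4, e5, hEs, show (3 : ℕ) - 1 = 2 from rfl, show ((3 : ℕ) : ℤ) + E = E + 3 by ring] at h
        rw [show -(E + 6) = -(E + 3 + 3) by ring]
        exact h
      -- norms of the pieces
      have hρ3n : padicNorm p ρ3 ≤ 1 := padicNorm_classRho_le_one b h0 hsn hn hp2 3
      have hρ4n : padicNorm p ρ4 ≤ 1 := by
        rw [hρ4]; split_ifs
        · exact padicNorm_classRho_le_one b h0 hsn hn hp2 4
        · simp
      have hρ5n : padicNorm p ρ5 ≤ 1 := by
        rw [hρ5]; split_ifs
        · exact padicNorm_classRho_le_one b h0 hsn hn hp2 5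
        · simp
      have hℓn : padicNorm p ℓ ≤ 1 := by rw [hℓ]; simpa using padicNorm.of_nat (p := p) (s / p)
      have hφs1 : padicNorm p φs ≤ 1 := padicNorm_phiHat_le_one b hp2 s
      have hcs1 : padicNorm p cs ≤ 1 := padicNorm_curvHat_le_one b hp2 s
      have hA : padicNorm p (gs - g * (1 - ℓ * p * φ + (ℓ * p) ^ 2 * c)) ≤ (p : ℚ) ^ (-(3 : ℤ)) :=
        padicNorm_gHat_sub_third_le b hp2 hx hs
      have hBφ : padicNorm p (φs - (φ + ℓ * p * φ₂)) ≤ (p : ℚ) ^ (-(2 : ℤ)) := padicNorm_phiHat_sub_second_le b hp2 hx hs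
      have hCc : padicNorm p (cs - c) ≤ (p : ℚ) ^ (-(1 : ℤ)) := padicNorm_curvHat_sub_le b hp2 hx hs
      have hDφ : padicNorm p (φs - φ) ≤ (p : ℚ) ^ (-(1 : ℤ)) := padicNorm_phiHat_sub_le b hp2 hs
      -- the algebra: `T s − (Theorem-B term) = (−p)^{E+3} · Δ`
      have hR := thirdOrder_transport_identity (p : ℚ) ℓ φ φs φ₂ c cs ρ3 ρ4 ρ5 hφ2c
      have e : T s = (pfData b 2 s - (-(p : ℚ)) ^ (E + 3) * gs * (ρ3 - (p : ℚ) * φs * ρ4 + (p : ℚ) ^ 2 * cs * ρ5))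
          + (-(p : ℚ)) ^ (E + 3) * ((gs - g * (1 - ℓ * p * φ + (ℓ * p) ^ 2 * c)) * (ρ3 - (p : ℚ) * φs * ρ4 + (p : ℚ) ^ 2 * cs * ρ5)
              + g * ((1 - ℓ * p * φ + (ℓ * p) ^ 2 * c) * (ρ3 - (p : ℚ) * φs * ρ4 + (p : ℚ) ^ 2 * cs * ρ5)
                  - (ρ3 - (p : ℚ) * φ * (ℓ * ρ3 + ρ4) + (p : ℚ) ^ 2 * c * (ℓ ^ 2 * ρ3 + 2 * ℓ * ρ4 + ρ5)))) := by
        rw [hTs]; ring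
      rw [e]
      refine (padicNorm.nonarchimedean (p := p)).trans (max_le hB ?_)
      rw [padicNorm.mul, hpow]
      -- `‖Δ‖ ≤ p⁻³`
      have hX : padicNorm p (ρ3 - (p : ℚ) * φs * ρ4 + (p : ℚ) ^ 2 * cs * ρ5) ≤ 1 := by
        refine (padicNorm.nonarchimedean (p := p)).trans (max_le ((padicNorm.sub (p := p)).trans (max_le hρ3n ?_)) ?_)
        · rw [padicNorm.mul, padicNorm.mul, hpn]
          calc (p : ℚ) ^ (-(1 : ℤ)) * padicNorm p φs * padicNorm p ρ4 ≤ 1 * 1 * 1 :=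
                mul_le_mul (mul_le_mul (zpow_le_one_of_nonpos₀ one_le_p (by norm_num)) hφs1 (padicNorm.nonneg _) zero_le_one)
                  hρ4n (padicNorm.nonneg _) (by positivity)
            _ = 1 := by ring
        · rw [padicNorm.mul, padicNorm.mul, padicNorm_pow_eq, hpn]
          calc ((p : ℚ) ^ (-(1 : ℤ))) ^ 2 * padicNorm p cs * padicNorm p ρ5 ≤ 1 ^ 2 * 1 * 1 :=
                mul_le_mul (mul_le_mul (pow_le_pow_left₀ (zpow_p_nonneg _) (zpow_le_one_of_nonpos₀ one_le_p (by norm_num)) 2)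
                  hcs1 (padicNorm.nonneg _) (by positivity)) hρ5n (padicNorm.nonneg _) (by positivity)
            _ = 1 := by ring
      have hΔ : padicNorm p ((gs - g * (1 - ℓ * p * φ + (ℓ * p) ^ 2 * c)) * (ρ3 - (p : ℚ) * φs * ρ4 + (p : ℚ) ^ 2 * cs * ρ5)
          + g * ((1 - ℓ * p * φ + (ℓ * p) ^ 2 * c) * (ρ3 - (p : ℚ) * φs * ρ4 + (p : ℚ) ^ 2 * cs * ρ5)
              - (ρ3 - (p : ℚ) * φ * (ℓ * ρ3 + ρ4) + (p : ℚ) ^ 2 * c * (ℓ ^ 2 * ρ3 + 2 * ℓ * ρ4 + ρ5)))) ≤ (p : ℚ) ^ (-(3 : ℤ)) := by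
        refine (padicNorm.nonarchimedean (p := p)).trans (max_le ?_ ?_)
        · rw [padicNorm.mul]
          calc _ ≤ (p : ℚ) ^ (-(3 : ℤ)) * 1 := mul_le_mul hA hX (padicNorm.nonneg _) (zpow_p_nonneg _)
            _ = _ := mul_one _
        · rw [padicNorm.mul, hR]
          have h1 : padicNorm p (-(p : ℚ) * (φs - (φ + ℓ * p * φ₂)) * ρ4) ≤ (p : ℚ) ^ (-(3 : ℤ)) := by
            rw [padicNorm.mul, padicNorm.mul, padicNorm.neg, hpn]
            calc (p : ℚ) ^ (-(1 : ℤ)) * padicNorm p (φs - (φ + ℓ * p * φ₂)) * padicNorm p ρ4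
                ≤ (p : ℚ) ^ (-(1 : ℤ)) * (p : ℚ) ^ (-(2 : ℤ)) * 1 :=
                  mul_le_mul (mul_le_mul_of_nonneg_left hBφ (zpow_p_nonneg _)) hρ4n (padicNorm.nonneg _)
                    (mul_nonneg (zpow_p_nonneg _) (zpow_p_nonneg _))
              _ = (p : ℚ) ^ (-(3 : ℤ)) := by rw [mul_one, ← zpow_add₀ hp0]; norm_num
          have h2 : padicNorm p ((p : ℚ) ^ 2 * (cs - c) * ρ5) ≤ (p : ℚ) ^ (-(3 : ℤ)) := by
            rw [padicNorm.mul, padicNorm.mul, padicNorm_pow_eq, hpn]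
            calc ((p : ℚ) ^ (-(1 : ℤ))) ^ 2 * padicNorm p (cs - c) * padicNorm p ρ5
                ≤ ((p : ℚ) ^ (-(1 : ℤ))) ^ 2 * (p : ℚ) ^ (-(1 : ℤ)) * 1 :=
                  mul_le_mul (mul_le_mul_of_nonneg_left hCc (by positivity)) hρ5n (padicNorm.nonneg _)
                    (mul_nonneg (by positivity) (zpow_p_nonneg _))
              _ = (p : ℚ) ^ (-(3 : ℤ)) := by rw [mul_one, ← zpow_natCast, ← zpow_mul, ← zpow_add₀ hp0]; norm_num
          have h3' : padicNorm p (ℓ * (p : ℚ) ^ 2 * φ * (φs - φ) * ρ4) ≤ (p : ℚ) ^ (-(3 : ℤ)) := by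
            rw [padicNorm.mul, padicNorm.mul, padicNorm.mul, padicNorm.mul, padicNorm_pow_eq, hpn]
            calc padicNorm p ℓ * ((p : ℚ) ^ (-(1 : ℤ))) ^ 2 * padicNorm p φ * padicNorm p (φs - φ) * padicNorm p ρ4
                ≤ 1 * ((p : ℚ) ^ (-(1 : ℤ))) ^ 2 * 1 * (p : ℚ) ^ (-(1 : ℤ)) * 1 :=
                  mul_le_mul (mul_le_mul (mul_le_mul (mul_le_mul_of_nonneg_right hℓn (by positivity)) hφ1
                    (padicNorm.nonneg _) (by positivity)) hDφ (padicNorm.nonneg _) (by positivity)) hρ4n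
                    (padicNorm.nonneg _) (by positivity)
              _ = (p : ℚ) ^ (-(3 : ℤ)) := by
                  rw [one_mul, mul_one, mul_one, ← zpow_natCast, ← zpow_mul, ← zpow_add₀ hp0]; norm_num
          have h4 : padicNorm p ((p : ℚ) ^ 3 * (-ℓ * φ * cs * ρ5 - ℓ ^ 2 * c * φs * ρ4 + ℓ ^ 2 * p * c * cs * ρ5)) ≤
              (p : ℚ) ^ (-(3 : ℤ)) := by
            rw [padicNorm.mul, padicNorm_pow_eq, hpn]
            have hin : padicNorm p (-ℓ * φ * cs * ρ5 - ℓ ^ 2 * c * φs * ρ4 + ℓ ^ 2 * p * c * cs * ρ5) ≤ 1 := by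
              have hp1 : padicNorm p (p : ℚ) ≤ 1 := by rw [hpn]; exact zpow_le_one_of_nonpos₀ one_le_p (by norm_num)
              have hℓ2 : padicNorm p (ℓ ^ 2) ≤ 1 := by rw [padicNorm_pow_eq]; exact pow_le_one₀ (padicNorm.nonneg _) hℓn
              refine (padicNorm.nonarchimedean (p := p)).trans (max_le ((padicNorm.sub (p := p)).trans (max_le ?_ ?_)) ?_)
              · rw [padicNorm.mul, padicNorm.mul, padicNorm.mul, padicNorm.neg]
                calc padicNorm p ℓ * padicNorm p φ * padicNorm p cs * padicNorm p ρ5 ≤ 1 * 1 * 1 * 1 :=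
                      mul_le_mul (mul_le_mul (mul_le_mul hℓn hφ1 (padicNorm.nonneg _) zero_le_one) hcs1 (padicNorm.nonneg _)
                        (by positivity)) hρ5n (padicNorm.nonneg _) (by positivity)
                  _ = 1 := by ring
              · rw [padicNorm.mul, padicNorm.mul, padicNorm.mul]
                calc padicNorm p (ℓ ^ 2) * padicNorm p c * padicNorm p φs * padicNorm p ρ4 ≤ 1 * 1 * 1 * 1 :=
                      mul_le_mul (mul_le_mul (mul_le_mul hℓ2 hc1 (padicNorm.nonneg _) zero_le_one) hφs1 (padicNorm.nonneg _)
                        (by positivity)) hρ4n (padicNorm.nonneg _) (by positivity)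
                  _ = 1 := by ring
              · rw [padicNorm.mul, padicNorm.mul, padicNorm.mul, padicNorm.mul]
                calc padicNorm p (ℓ ^ 2) * padicNorm p (p : ℚ) * padicNorm p c * padicNorm p cs * padicNorm p ρ5
                    ≤ 1 * 1 * 1 * 1 * 1 :=
                      mul_le_mul (mul_le_mul (mul_le_mul (mul_le_mul hℓ2 hp1 (padicNorm.nonneg _) zero_le_one) hc1
                        (padicNorm.nonneg _) (by positivity)) hcs1 (padicNorm.nonneg _) (by positivity)) hρ5n
                        (padicNorm.nonneg _) (by positivity)
                  _ = 1 := by ring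
            calc ((p : ℚ) ^ (-(1 : ℤ))) ^ 3 * _ ≤ ((p : ℚ) ^ (-(1 : ℤ))) ^ 3 * 1 :=
                  mul_le_mul_of_nonneg_left hin (by positivity)
              _ = (p : ℚ) ^ (-(3 : ℤ)) := by rw [mul_one, ← zpow_natCast, ← zpow_mul]; norm_num
          have hsum : padicNorm p (-(p : ℚ) * (φs - (φ + ℓ * p * φ₂)) * ρ4 + (p : ℚ) ^ 2 * (cs - c) * ρ5
              + ℓ * (p : ℚ) ^ 2 * φ * (φs - φ) * ρ4
              + (p : ℚ) ^ 3 * (-ℓ * φ * cs * ρ5 - ℓ ^ 2 * c * φs * ρ4 + ℓ ^ 2 * p * c * cs * ρ5)) ≤ (p : ℚ) ^ (-(3 : ℤ)) :=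
            (padicNorm.nonarchimedean (p := p)).trans (max_le ((padicNorm.nonarchimedean (p := p)).trans
              (max_le ((padicNorm.nonarchimedean (p := p)).trans (max_le h1 h2)) h3')) h4)
          calc padicNorm p g * _ ≤ 1 * (p : ℚ) ^ (-(3 : ℤ)) := mul_le_mul hgx1 hsum (padicNorm.nonneg _) zero_le_one
            _ = _ := one_mul _
      calc (p : ℚ) ^ (-(E + 3)) * _ ≤ (p : ℚ) ^ (-(E + 3)) * (p : ℚ) ^ (-(3 : ℤ)) :=
            mul_le_mul_of_nonneg_left hΔ (zpow_p_nonneg _)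
        _ = (p : ℚ) ^ (-(E + 6)) := by rw [← zpow_add₀ hp0]; ring_nf
    · -- no pole of order ≥ 3 at `s`: the term vanishes
      have hTs : T s = 0 := by
        simp only [hT, if_neg h3, if_neg (show ¬ netExp b s ≤ -4 by omega), if_neg (show ¬ netExp b s ≤ -5 by omega)]
        rw [pfData_eq_zero_of_order_le b hb hsn (by norm_num) (by push_cast; omega)]
        ring
      rw [hTs, padicNorm.zero]; exact zpow_p_nonneg _
  apply val_ge_of_padicNorm_le hne
  rw [hsplit]
  exact padicNorm.sum_le' hterm (zpow_p_nonneg _)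

end Summit.KontsevichZagierPeriods.Zeta5Search.SecondOrder

end
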